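import Literature.Combinatorics.Optimization.SeparatingFunctionalPsdRank
import Literature.Combinatorics.Optimization.PseudoDensityFourier
import HarnessLib

/-!
# Pseudo-densities on `x_S` are nonnegative on squares of low `S`-degree (the positivity step of
# Lee–Raghavendra–Steurer 2015, Thm 3.5 / Lemma 3.6), PROVED

The printed proof of LRS's degree-reduction theorem (Thm 3.5 = Thm 3.2, the named fact
`LeeRaghavendraSteurer2015_thm35` of `SeparatingFunctionalPsdRank.lean`) rests on two lemmas.
Lemma 3.7 is proved in `FourierTailRandomSubset.lean`.  Lemma 3.6 (p. 16) is Cauchy–Schwarz plus ONE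
positivity fact: "Since `x ↦ ‖A(S) B_{S,low}(x)‖_F²` is a sum of squares of polynomials of degree at
most `d/2` in the variables `S` and `D` is a degree-`d` pseudo-density, the expectation
`E D(x_S) ‖A B_low‖_F²` is non-negative" (also the observation on p. 14: `L_D(N) ≥ 0` whenever
`N(S,x) = Tr(A_S² B_x²)` with `deg(x ↦ B_x) ≤ d/2`).  This file PROVES that fact:

* `IsPseudoDensity.cubeExpect_cubeRestrict_mul_sq_nonneg` — for a degree-`d` pseudo-density `D` on
  `{0,1}^m`, an `m`-subset `S ⊆ [n]` and `g : {0,1}ⁿ → ℝ` whose Fourier–Walsh support has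
  `|α ∩ S| ≤ d/2` ("degree at most `d/2` in the variables `S`"), `E_x D(x_S) g(x)² ≥ 0`;
* `IsPseudoDensity.cubeExpect_cubeRestrict_mul_sq_nonneg_of_hasDegreeLE` — in particular for every
  `g` of (total) degree `≤ d/2`.

Proof (conditioning on the coordinates outside `S`): split `x = (x_S, x_{S̄})` along
`Equiv.piEquivPiSubtypeProd` and reindex `x_S` by `Fin m`; for each fixed `x_{S̄} = z` the section
`w ↦ g(w, z)` is `Σ_α ĝ(α) χ_{α∖S}(z) · χ_{β(α)}(w)` with `|β(α)| = |α ∩ S| ≤ d/2`, hence of degree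
`≤ d/2` on `{0,1}^m`, so `E_w D(w) g(w,z)² ≥ 0` by the definition of a pseudo-density; sum over `z`.

Source: J. R. Lee, P. Raghavendra, D. Steurer, STOC 2015 [LeeRaghavendraSteurer2015], held text
`paper:arxiv-1411.6317`: §3.1 p. 14 (the display `L_D(N) = E_S(E_x D(x_S)‖A_S B_x‖_F²) ≥ 0`),
Lemma 3.6 proof (p. 16).  Theorems only.
-/

open Finset
open Literature.Probability.RandomGraphs.LowDegree (walsh sgn)
open Literature.Computability.Complexity.LowDegree (cubeFourierCoeff sum_cubeFourierCoeff_mul_walsh)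

namespace Literature.Combinatorics.Optimization

variable {n m d : ℕ}

/-- **Positivity of a pseudo-density on squares of low `S`-degree (PROVED).**  Let `D` be a
degree-`d` pseudo-density on `{0,1}^m`, `S ⊆ [n]` an `m`-subset and `g : {0,1}ⁿ → ℝ` with
`ĝ(α) = 0` whenever `|α ∩ S| > d/2` (degree `≤ d/2` in the variables `S`).  Then
`E_x D(x_S) g(x)² ≥ 0`. [cite: LeeRaghavendraSteurer2015, Lemma 3.6 proof (p. 16: "the expectation E D(x_S)‖A B_low‖_F² is non-negative") and §3.1 (p. 14)] -/
theorem IsPseudoDensity.cubeExpect_cubeRestrict_mul_sq_nonneg {D : (Fin m → Bool) → ℝ}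
    (hD : IsPseudoDensity d D) (S : {S : Finset (Fin n) // S.card = m}) (g : (Fin n → Bool) → ℝ)
    (hg : ∀ α : Finset (Fin n), d / 2 < (α ∩ S.1).card → cubeFourierCoeff g α = 0) :
    0 ≤ cubeExpect (fun x => D (cubeRestrict S x) * g x ^ 2) := by
  classical
  unfold cubeExpect
  refine div_nonneg ?_ (by positivity)
  -- coordinates in `S` / outside `S`, and `S ≃ Fin m` along the increasing enumeration
  let E := Equiv.piEquivPiSubtypeProd (fun i : Fin n => i ∈ S.1) (fun _ => Bool)
  let e : Fin m ↪o Fin n := S.1.orderEmbOfFin S.2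
  let eS : {i // i ∈ S.1} ≃ Fin m := (S.1.orderIsoOfFin S.2).toEquiv.symm
  let ψ : ({i // i ∈ S.1} → Bool) ≃ (Fin m → Bool) := Equiv.arrowCongr eS (Equiv.refl Bool)
  have hres : ∀ x : Fin n → Bool, cubeRestrict S x = ψ (E x).1 := fun x => rfl
  -- the point of `{0,1}ⁿ` with `S`-part `w` and outside part `z`
  let pt : (Fin m → Bool) → ({i // i ∉ S.1} → Bool) → (Fin n → Bool) :=
    fun w z => E.symm (ψ.symm w, z)
  have hpt_out : ∀ w z (i : Fin n) (hi : i ∉ S.1), pt w z i = z ⟨i, hi⟩ := by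
    intro w z i hi
    show (if h : i ∈ S.1 then (ψ.symm w) ⟨i, h⟩ else z ⟨i, h⟩) = z ⟨i, hi⟩
    rw [dif_neg hi]
  have hpt_in : ∀ w z (j : Fin m), pt w z (e j) = w j := by
    intro w z j
    have hj : e j ∈ S.1 := Finset.orderEmbOfFin_mem S.1 S.2 j
    show (if h : e j ∈ S.1 then (ψ.symm w) ⟨e j, h⟩ else z ⟨e j, h⟩) = w j
    rw [dif_pos hj]
    show w (eS ⟨e j, hj⟩) = w j
    have : (⟨e j, hj⟩ : {i // i ∈ S.1}) = S.1.orderIsoOfFin S.2 j := Subtype.ext rfl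
    rw [this]
    show w ((S.1.orderIsoOfFin S.2).symm (S.1.orderIsoOfFin S.2 j)) = w j
    rw [OrderIso.symm_apply_apply]
  -- reindex the sum over `x` by `(w, z)`
  have hsum : ∑ x : Fin n → Bool, D (cubeRestrict S x) * g x ^ 2 =
      ∑ z : {i // i ∉ S.1} → Bool, ∑ w : Fin m → Bool, D w * g (pt w z) ^ 2 := by
    calc ∑ x : Fin n → Bool, D (cubeRestrict S x) * g x ^ 2
        = ∑ p : ({i // i ∈ S.1} → Bool) × ({i // i ∉ S.1} → Bool),
            D (cubeRestrict S (E.symm p)) * g (E.symm p) ^ 2 :=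
          Fintype.sum_equiv E _ _ fun x => by simp only [Equiv.symm_apply_apply]
      _ = ∑ a : {i // i ∈ S.1} → Bool, ∑ z : {i // i ∉ S.1} → Bool,
            D (cubeRestrict S (E.symm (a, z))) * g (E.symm (a, z)) ^ 2 := Fintype.sum_prod_type _
      _ = ∑ a : {i // i ∈ S.1} → Bool, ∑ z : {i // i ∉ S.1} → Bool,
            D (ψ a) * g (pt (ψ a) z) ^ 2 := by
          refine sum_congr rfl fun a _ => sum_congr rfl fun z _ => ?_
          rw [hres, Equiv.apply_symm_apply]
          simp only [pt, Equiv.symm_apply_apply]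
      _ = ∑ w : Fin m → Bool, ∑ z : {i // i ∉ S.1} → Bool, D w * g (pt w z) ^ 2 :=
          Fintype.sum_equiv ψ _ (fun w => ∑ z : {i // i ∉ S.1} → Bool, D w * g (pt w z) ^ 2)
            fun a => rfl
      _ = ∑ z : {i // i ∉ S.1} → Bool, ∑ w : Fin m → Bool, D w * g (pt w z) ^ 2 := Finset.sum_comm
  rw [hsum]
  refine sum_nonneg fun z _ => ?_
  -- the section `w ↦ g (pt w z)` has degree `≤ d/2` on `{0,1}^m`
  let β : Finset (Fin n) → Finset (Fin m) := fun α => univ.filter fun j => e j ∈ α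
  have hβmap : ∀ α : Finset (Fin n), (β α).map e.toEmbedding = α ∩ S.1 := by
    intro α
    ext i
    simp only [β, mem_map, mem_filter, mem_univ, true_and, mem_inter, RelEmbedding.coe_toEmbedding]
    constructor
    · rintro ⟨j, hj, rfl⟩
      exact ⟨hj, Finset.orderEmbOfFin_mem S.1 S.2 j⟩
    · rintro ⟨hiα, hiS⟩
      have : i ∈ Set.range e := by rw [Finset.range_orderEmbOfFin]; exact hiS
      obtain ⟨j, rfl⟩ := this
      exact ⟨j, hiα, rfl⟩
  have hβcard : ∀ α : Finset (Fin n), (β α).card = (α ∩ S.1).card := fun α => by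
    rw [← hβmap α, card_map]
  -- `χ_α (pt w z) = χ_{α∖S}(z-part) · χ_{β α}(w)`
  let w₀ : Fin m → Bool := fun _ => false
  have hout : ∀ α w, walsh (α \ S.1) (pt w z) = walsh (α \ S.1) (pt w₀ z) := by
    intro α w
    unfold Literature.Probability.RandomGraphs.LowDegree.walsh
    refine prod_congr rfl fun i hi => ?_
    have hiS : i ∉ S.1 := (mem_sdiff.1 hi).2
    rw [hpt_out w z i hiS, hpt_out w₀ z i hiS]
  have hin : ∀ α w, walsh (α ∩ S.1) (pt w z) = walsh (β α) w := by
    intro α w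
    unfold Literature.Probability.RandomGraphs.LowDegree.walsh
    rw [← hβmap α, prod_map]
    refine prod_congr rfl fun j _ => ?_
    rw [RelEmbedding.coe_toEmbedding, hpt_in]
  have hwalsh : ∀ α w, walsh α (pt w z) = walsh (α \ S.1) (pt w₀ z) * walsh (β α) w := by
    intro α w
    rw [← hout α w, ← hin α w, walsh_mul_walsh_of_disjoint (disjoint_sdiff_inter α S.1),
      sdiff_union_inter]
  have hrepr : (fun w => g (pt w z)) =
      fun w => ∑ α : Finset (Fin n), (cubeFourierCoeff g α * walsh (α \ S.1) (pt w₀ z)) * walsh (β α) w := by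
    funext w
    rw [← sum_cubeFourierCoeff_mul_walsh g (pt w z)]
    exact sum_congr rfl fun α _ => by rw [hwalsh]; ring
  have hdeg : HasDegreeLE (d / 2) (fun w => g (pt w z)) := by
    rw [hrepr]
    refine HasDegreeLE.sum univ fun α _ => ?_
    by_cases hα : d / 2 < (α ∩ S.1).card
    · have h0 : (fun w => (cubeFourierCoeff g α * walsh (α \ S.1) (pt w₀ z)) * walsh (β α) w) =
          fun _ => (0 : ℝ) := by
        funext w; rw [hg α hα]; ring
      rw [h0]
      exact HasDegreeLE.const _ _
    · push Not at hα
      exact (hasDegreeLE_walsh_of_card_le ((hβcard α).le.trans hα)).const_mul _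
  -- pseudo-density positivity on the square
  have hpos := hD.2 _ hdeg
  unfold cubeExpect at hpos
  have h2 : (0 : ℝ) < 2 ^ m := by positivity
  have := mul_nonneg hpos h2.le
  rwa [div_mul_cancel₀ _ h2.ne'] at this

/-- In particular `E_x D(x_S) g(x)² ≥ 0` for every `g : {0,1}ⁿ → ℝ` of degree `≤ d/2` (the case
"`x ↦ B_x` has degree at most `d/2`" of p. 14). [cite: LeeRaghavendraSteurer2015, §3.1 (p. 14: "L_D(N) = E_S(E_x D(x_S)‖A_S B_x‖_F²) ≥ 0")] -/
theorem IsPseudoDensity.cubeExpect_cubeRestrict_mul_sq_nonneg_of_hasDegreeLE {D : (Fin m → Bool) → ℝ}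
    (hD : IsPseudoDensity d D) (S : {S : Finset (Fin n) // S.card = m}) {g : (Fin n → Bool) → ℝ}
    (hg : HasDegreeLE (d / 2) g) :
    0 ≤ cubeExpect (fun x => D (cubeRestrict S x) * g x ^ 2) :=
  hD.cubeExpect_cubeRestrict_mul_sq_nonneg S g fun _ hα =>
    hg.cubeFourierCoeff_eq_zero (lt_of_lt_of_le hα (card_le_card inter_subset_left))

/-- **`L_D(N) ≥ 0` for low-degree square factorizations** (p. 14): if
`N(S,x) = Σ_k g_{S,k}(x)²` with every `g_{S,k}` of degree `≤ d/2` (e.g. `N(S,x) = ‖A_S B_x‖_F²` with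
`deg(B) ≤ d/2`), then `L_D(N) ≥ 0`. [cite: LeeRaghavendraSteurer2015, §3.1 (p. 14: "L_D(N) is nonnegative for all matrices N that admit a factorization in terms of squares of low-degree polynomials")] -/
theorem IsPseudoDensity.sepFunctional_nonneg_of_sq {D : (Fin m → Bool) → ℝ} (hD : IsPseudoDensity d D)
    {ι : Type*} (s : Finset ι)
    (gf : {S : Finset (Fin n) // S.card = m} → ι → (Fin n → Bool) → ℝ)
    (hgf : ∀ S k, HasDegreeLE (d / 2) (gf S k)) :
    0 ≤ sepFunctional D (fun S x => ∑ k ∈ s, gf S k x ^ 2) := by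
  unfold sepFunctional subsetCubeExpect
  refine div_nonneg (sum_nonneg fun S _ => ?_) (by positivity)
  have h : ∀ x : Fin n → Bool, D (cubeRestrict S x) * ∑ k ∈ s, gf S k x ^ 2 =
      ∑ k ∈ s, D (cubeRestrict S x) * gf S k x ^ 2 := fun x => mul_sum _ _ _
  simp_rw [h]
  rw [sum_comm]
  refine sum_nonneg fun k _ => ?_
  have := hD.cubeExpect_cubeRestrict_mul_sq_nonneg_of_hasDegreeLE S (hgf S k)
  unfold cubeExpect at this
  have h2 : (0 : ℝ) < 2 ^ n := by positivity
  have := mul_nonneg this h2.le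
  rwa [div_mul_cancel₀ _ h2.ne'] at this

end Literature.Combinatorics.Optimization
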